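import Literature.NumberTheory.LFunctions.RieszCriterionNecessityProofs
import Literature.NumberTheory.LFunctions.BaezDuarteSequentialProofs
import HarnessLib

/-!
# RH-EQUIVALENT (PROVED AS AN EQUIVALENCE) · Báez-Duarte's sequential criterion `BaezDuarte2005_thm_1_1`: the direction "RH ⟹ `c_k ≪ k^{−3/4+ε}`" PROVED by the printed summation by parts against `M(x) ≪ x^{1/2+ε}`; with the tree's "⟸" this DISCHARGES the named fact (`BaezDuarte2005_thm_1_1_holds`) — nothing here bears on the truth of RH

Literature-typing tranche `rh-lit-broughan-2` (Broughan, *Equivalents of the Riemann Hypothesis*,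
Vol. 2, Ch. 2 "Series Equivalents" (Index: "Báez-Duarte series criterion 3, 19")). The typed named
fact `BaezDuarte2005_thm_1_1` (file `RieszTypeSeriesCriteria`) reads
`RiemannHypothesis ↔ ∀ ε > 0, c_k = O(k^{−3/4+ε})`, `c_k = Σ_{j≤k} (−1)^j (k choose j)/ζ(2j+2)`
(`baezDuarteCoeff`). The file `BaezDuarteSequentialProofs` PROVED "⟸"
(`BaezDuarte2005_thm_1_1.mpr_holds`). This file PROVES "⟹" following the printed proof
[BaezDuarte2005, §3 "Proof of the necessity of the condition"] and assembles
`theorem BaezDuarte2005_thm_1_1_holds : BaezDuarte2005_thm_1_1` (D-0026 discharge; no new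
definition, no new fact).

## The printed proof (Báez-Duarte 2005 §3, p. 5 of arXiv:math/0307215) and the road taken

"Assume now that the Riemann hypothesis is true. If as usual we write `M(x) := Σ_{n≤x} μ(n)`, we then
have `M(x) ≪ x^{1/2+2ε}`. We can transform the second expression for `c_k` in (coeffs1)
[`c_k = Σ_{n≥1} μ(n) n^{−2} (1 − n^{−2})^k`] summing it by parts to obtain
`c_k = ∫_1^∞ M(x) d/dx (x^{−2}(1−x^{−2})^k) dx` … `c_k ≪ k ∫_0^1 x^{5/2−2ε}(1−x²)^k dx +
∫_0^1 x^{1/2−2ε}(1−x²)^k dx` … a classical beta integral … `c_k ≪ k^{−3/4+ε}`."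
Steps followed: (i) `c_k = Σ μ(n) n^{−2}(1−n^{−2})^k` (`hasSum_baezDuarteCoeff_moebius`, from
`1/ζ(2j+2) = Σ μ(n) n^{−2j−2}` and the binomial theorem); (ii) summation by parts against `M`
(the tree's discrete `abs_tsum_mul_le_of_abel`, file `RieszCriterionNecessityProofs`), with the tree's
`RH ⟹ |M(n)| ≤ C n^{1/2+ε}` (`mertensFunction_isBigO_of_riemannHypothesis`); (iii) DEVIATION (shorter
in Lean than the beta integral): the weight's derivative
`d/dt (t^{−2}(1−t^{−2})^k) = −2t^{−3}((1−y)^k − k y (1−y)^{k−1})`, `y = t^{−2}`, is bounded through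
`(1−y)^k ≤ e^{−ky}`, `(1−y)^{k−1} ≤ e·e^{−ky}` and `e^{−s} ≤ 2s^{−a}`, `s e^{−s} ≤ 2 s^{−a}` (`0 ≤ a ≤ 1`) by
`16 k^{−a} t^{2a−3}`; with `a = 3/4 − ε` the summed-by-parts series is dominated by
`16 C k^{−3/4+ε} Σ n^{−1−ε}`.

* §1 `hasSum_moebius_div_pow_real` (`Σ μ(n)/n^m = 1/ζ(m)`, `m ≥ 2`, in `ℝ`),
  `hasSum_baezDuarteCoeff_moebius` (Báez-Duarte's (coeffs1)).
* §2 `rpow_mul_exp_neg_le_two` (`s^a e^{−s} ≤ 2`, `0 ≤ a ≤ 2`), `hasDerivAt_bdWeight`,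
  `norm_deriv_bdWeight_le`, `abs_bdWeight_sub_le`.
* §3 `baezDuarteCoeff_isBigO_of_riemannHypothesis`, `BaezDuarte2005_thm_1_1.mp_holds`,
  **`BaezDuarte2005_thm_1_1_holds`**.

No new definitions, no new facts (D-0026); standard axioms only.

## References

* [BaezDuarte2005] L. Báez-Duarte, *A sequential Riesz-like criterion for the Riemann hypothesis*,
  Int. J. Math. Math. Sci. 2005:21, 3527–3537 (arXiv:math/0307215), Thm. 1.1, §2 (coeffs1), §3
  [corpus: paper:arxiv-math_0307215 pp. 4–5].
* [Titchmarsh1986] E. C. Titchmarsh, *The Theory of the Riemann Zeta-Function*, 2nd ed., §14.25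
  (`M(x)`), §14.32.
* [Broughan2017] K. Broughan, *Equivalents of the Riemann Hypothesis*, Vol. 2, Ch. 2 (secondary; not held).
-/

noncomputable section

open Filter Asymptotics Finset Topology

open scoped Real Nat

namespace Literature.NumberTheory.LFunctions

/-! ## §1 `c_k = Σ_{n≥1} μ(n) n^{−2} (1 − n^{−2})^k` -/

/-- `Σ_n μ(n)/n^m = 1/ζ(m)` for natural `m ≥ 2`, as a real series (`ζ(m)` entering as the real part
of Mathlib's `riemannZeta m`; the `n = 0` term is `0`). [cite: BaezDuarte2005, §2 (coeffs1) (1/ζ(2j+2) = Σ μ(n) n^{−2j−2})] -/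
theorem hasSum_moebius_div_pow_real {m : ℕ} (hm : 2 ≤ m) :
    HasSum (fun n : ℕ ↦ ((ArithmeticFunction.moebius n : ℤ) : ℝ) / (n : ℝ) ^ m)
      ((riemannZeta (m : ℝ)).re)⁻¹ := by
  have hw : 1 < ((m : ℝ) : ℂ).re := by simp; exact_mod_cast hm
  have h := hasSum_moebius_term_inv_riemannZeta hw
  rw [riemannZeta_ofReal_eq_re, ← Complex.ofReal_inv] at h
  have hterm : ∀ n : ℕ, LSeries.term (fun n ↦ ((ArithmeticFunction.moebius n : ℤ) : ℂ)) ((m : ℝ) : ℂ) n =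
      ((((ArithmeticFunction.moebius n : ℤ) : ℝ) / (n : ℝ) ^ m : ℝ) : ℂ) := by
    intro n
    rcases Nat.eq_zero_or_pos n with rfl | hn
    · simp [LSeries.term]
    · rw [LSeries.term_of_ne_zero hn.ne', Complex.ofReal_natCast, Complex.cpow_natCast]
      push_cast
      rfl
  simp_rw [hterm] at h
  exact Complex.hasSum_ofReal.1 h

/-- **Báez-Duarte's second expression for `c_k`** ((coeffs1), §2):
`c_k = Σ_{j≤k} (−1)^j (k choose j) Σ_n μ(n) n^{−2j−2} = Σ_{n≥1} μ(n) n^{−2} (1 − n^{−2})^k`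
(binomial theorem; a finite sum of convergent series). [cite: BaezDuarte2005, §2 eq. (coeffs1) (proof of Prop. 2.1)] -/
theorem hasSum_baezDuarteCoeff_moebius (k : ℕ) :
    HasSum (fun n : ℕ ↦ ((n : ℝ) ^ 2)⁻¹ * (1 - ((n : ℝ) ^ 2)⁻¹) ^ k *
      ((ArithmeticFunction.moebius n : ℤ) : ℝ)) (baezDuarteCoeff k) := by
  have hj : ∀ j ∈ range (k + 1), HasSum (fun n : ℕ ↦ (-1 : ℝ) ^ j * (k.choose j : ℝ) *
      (((ArithmeticFunction.moebius n : ℤ) : ℝ) / (n : ℝ) ^ (2 * j + 2)))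
      ((-1 : ℝ) ^ j * (k.choose j : ℝ) / (riemannZeta (2 * j + 2 : ℝ)).re) := by
    intro j _
    have h := (hasSum_moebius_div_pow_real (m := 2 * j + 2) (by omega)).mul_left
      ((-1 : ℝ) ^ j * (k.choose j : ℝ))
    have e : (((2 * j + 2 : ℕ) : ℝ)) = 2 * (j : ℝ) + 2 := by push_cast; ring
    rw [e] at h
    rwa [div_eq_mul_inv]
  have hsum := hasSum_sum hj
  have hval : ∑ i ∈ range (k + 1), (-1 : ℝ) ^ i * (k.choose i : ℝ) / (riemannZeta (2 * i + 2 : ℝ)).re =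
      baezDuarteCoeff k := rfl
  rw [hval] at hsum
  refine hsum.congr_fun fun n ↦ ?_
  -- `n^{-2} (1 - n^{-2})^k μ(n) = Σ_i (−1)^i C(k,i) μ(n)/n^{2i+2}` (binomial theorem)
  rw [sub_eq_neg_add, add_pow, Finset.mul_sum, Finset.sum_mul]
  refine Finset.sum_congr rfl fun i _ ↦ ?_
  rw [one_pow, mul_one, show (n : ℝ) ^ (2 * i + 2) = ((n : ℝ) ^ 2) ^ (i + 1) by ring, neg_pow,
    div_eq_mul_inv, ← inv_pow, pow_succ]
  ring

/-! ## §2 The summation weight `t ↦ t^{−2}(1 − t^{−2})^k` and its derivative -/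

/-- `s^a e^{−s} ≤ 2` for `s ≥ 0`, `0 ≤ a ≤ 2` (`s ≤ 1`: `≤ 1`; `s ≥ 1`: `s^a ≤ s² ≤ 2e^s`).
[cite: BaezDuarte2005, §3 (elementary estimate replacing the beta integral)] -/
theorem rpow_mul_exp_neg_le_two {s a : ℝ} (hs : 0 ≤ s) (ha0 : 0 ≤ a) (ha2 : a ≤ 2) :
    s ^ a * Real.exp (-s) ≤ 2 := by
  have he : Real.exp (-s) ≤ 1 := Real.exp_le_one_iff.2 (by linarith)
  rcases le_or_gt s 1 with hs1 | hs1
  · have h1 : s ^ a ≤ 1 := Real.rpow_le_one hs hs1 ha0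
    calc s ^ a * Real.exp (-s) ≤ 1 * 1 := by gcongr
      _ ≤ 2 := by norm_num
  · have h1 : s ^ a ≤ s ^ (2 : ℝ) := Real.rpow_le_rpow_of_exponent_le hs1.le ha2
    rw [Real.rpow_two] at h1
    have h2 : s ^ 2 * Real.exp (-s) ≤ 2 := by
      have h := Real.pow_div_factorial_le_exp s hs 2
      norm_num [Nat.factorial] at h
      rw [Real.exp_neg, ← div_eq_mul_inv, div_le_iff₀ (Real.exp_pos s)]
      linarith
    calc s ^ a * Real.exp (-s) ≤ s ^ 2 * Real.exp (-s) := by gcongr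
      _ ≤ 2 := h2

/-- `e^{−s} ≤ 2 s^{−a}` for `s > 0`, `0 ≤ a ≤ 2`. [cite: BaezDuarte2005, §3 (elementary estimate replacing the beta integral)] -/
theorem exp_neg_le_two_mul_rpow_neg {s a : ℝ} (hs : 0 < s) (ha0 : 0 ≤ a) (ha2 : a ≤ 2) :
    Real.exp (-s) ≤ 2 * s ^ (-a) := by
  have h := rpow_mul_exp_neg_le_two hs.le ha0 ha2
  have hsa : 0 < s ^ a := Real.rpow_pos_of_pos hs a
  rw [Real.rpow_neg hs.le, ← div_eq_mul_inv, le_div_iff₀ hsa, mul_comm]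
  exact h

/-- `s e^{−s} ≤ 2 s^{−a}` for `s > 0`, `0 ≤ a ≤ 1` (the case `a + 1` of `rpow_mul_exp_neg_le_two`).
[cite: BaezDuarte2005, §3 (elementary estimate replacing the beta integral)] -/
theorem mul_exp_neg_le_two_mul_rpow_neg {s a : ℝ} (hs : 0 < s) (ha0 : 0 ≤ a) (ha1 : a ≤ 1) :
    s * Real.exp (-s) ≤ 2 * s ^ (-a) := by
  have h := rpow_mul_exp_neg_le_two hs.le (by linarith : 0 ≤ a + 1) (by linarith : a + 1 ≤ 2)
  have hsa : 0 < s ^ a := Real.rpow_pos_of_pos hs a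
  rw [Real.rpow_add hs, Real.rpow_one] at h
  rw [Real.rpow_neg hs.le, ← div_eq_mul_inv, le_div_iff₀ hsa]
  calc s * Real.exp (-s) * s ^ a = s ^ a * s * Real.exp (-s) := by ring
    _ ≤ 2 := h

/-- Derivative of the weight `t ↦ t^{−2}(1 − t^{−2})^k` at `t ≠ 0`:
`((1−y)^k − k y (1−y)^{k−1}) · (−2/t³)`, `y = t^{−2}`. [cite: BaezDuarte2005, §3 (d/dx (x^{−2}(1−x^{−2})^k))] -/
theorem hasDerivAt_bdWeight (k : ℕ) {t : ℝ} (ht : t ≠ 0) :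
    HasDerivAt (fun t : ℝ ↦ (t ^ 2)⁻¹ * (1 - (t ^ 2)⁻¹) ^ k)
      (((1 - (t ^ 2)⁻¹) ^ k - k * (t ^ 2)⁻¹ * (1 - (t ^ 2)⁻¹) ^ (k - 1)) * (-2 / t ^ 3)) t := by
  -- inner `y(t) = (t²)⁻¹`
  have hy : HasDerivAt (fun t : ℝ ↦ (t ^ 2)⁻¹) (-2 / t ^ 3) t := by
    have h := (hasDerivAt_pow 2 t).inv (pow_ne_zero 2 ht)
    have e : -(↑(2 : ℕ) * t ^ (2 - 1)) / (t ^ 2) ^ 2 = -2 / t ^ 3 := by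
      field_simp
      ring
    rw [e] at h
    exact h
  -- outer `ψ(y) = y (1 - y)^k`
  have hψ : ∀ y : ℝ, HasDerivAt (fun y : ℝ ↦ y * (1 - y) ^ k)
      ((1 - y) ^ k - k * y * (1 - y) ^ (k - 1)) y := by
    intro y
    have h1 : HasDerivAt (fun y : ℝ ↦ (1 - y) ^ k) ((k : ℝ) * (1 - y) ^ (k - 1) * (-1)) y :=
      ((hasDerivAt_id y).const_sub 1).pow k
    have h := (hasDerivAt_id y).mul h1
    have e : 1 * (1 - y) ^ k + id y * ((k : ℝ) * (1 - y) ^ (k - 1) * (-1)) =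
        (1 - y) ^ k - k * y * (1 - y) ^ (k - 1) := by
      simp only [id]; ring
    rw [e] at h
    exact h
  have := (hψ ((t ^ 2)⁻¹)).comp t hy
  simpa [Function.comp_def, mul_assoc] using this

/-- Bound for the weight's derivative: for `t ≥ 1`, `k ≥ 1`, `0 ≤ a ≤ 1`,
`|((1−y)^k − k y(1−y)^{k−1})·(−2/t³)| ≤ 16 k^{−a} t^{2a−3}` (`y = t^{−2}`; via `(1−y)^k ≤ e^{−ky}`,
`(1−y)^{k−1} ≤ e·e^{−ky}`, `e^{−s} ≤ 2s^{−a}`, `s e^{−s} ≤ 2s^{−a}`, `s = k y`).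
[cite: BaezDuarte2005, §3 (estimate of the summation weight; beta-integral step replaced)] -/
theorem norm_deriv_bdWeight_le {k : ℕ} (hk : 1 ≤ k) {a : ℝ} (ha0 : 0 ≤ a) (ha1 : a ≤ 1) {t : ℝ}
    (ht : 1 ≤ t) :
    ‖((1 - (t ^ 2)⁻¹) ^ k - k * (t ^ 2)⁻¹ * (1 - (t ^ 2)⁻¹) ^ (k - 1)) * (-2 / t ^ 3)‖ ≤
      16 * (k : ℝ) ^ (-a) * t ^ (2 * a - 3) := by
  have ht0 : 0 < t := by linarith
  have hk0 : (0 : ℝ) < k := by exact_mod_cast hk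
  set y : ℝ := (t ^ 2)⁻¹ with hy
  have hy0 : 0 < y := by positivity
  have hy1 : y ≤ 1 := by
    rw [hy]
    exact inv_le_one_of_one_le₀ (one_le_pow₀ ht)
  have h1y : 0 ≤ 1 - y := by linarith
  have h1ye : 1 - y ≤ Real.exp (-y) := by linarith [Real.add_one_le_exp (-y)]
  set s : ℝ := k * y with hs
  have hs0 : 0 < s := by positivity
  -- `(1-y)^k ≤ e^{-s}`
  have hA : (1 - y) ^ k ≤ Real.exp (-s) := by
    calc (1 - y) ^ k ≤ Real.exp (-y) ^ k := pow_le_pow_left₀ h1y h1ye k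
      _ = Real.exp (-s) := by rw [← Real.exp_nat_mul, hs]; ring_nf
  -- `(1-y)^(k-1) ≤ e · e^{-s}`
  have hB : (1 - y) ^ (k - 1) ≤ Real.exp 1 * Real.exp (-s) := by
    calc (1 - y) ^ (k - 1) ≤ Real.exp (-y) ^ (k - 1) := pow_le_pow_left₀ h1y h1ye (k - 1)
      _ = Real.exp (y - s) := by
          rw [← Real.exp_nat_mul, hs, Nat.cast_sub hk, Nat.cast_one]; ring_nf
      _ ≤ Real.exp 1 * Real.exp (-s) := by
          rw [← Real.exp_add]; exact Real.exp_le_exp.2 (by linarith)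
  -- the bracket
  have hsa : Real.exp (-s) ≤ 2 * s ^ (-a) := exp_neg_le_two_mul_rpow_neg hs0 ha0 (by linarith)
  have hsb : s * Real.exp (-s) ≤ 2 * s ^ (-a) := mul_exp_neg_le_two_mul_rpow_neg hs0 ha0 ha1
  have he3 : Real.exp 1 ≤ 3 := by
    have := Real.exp_one_lt_d9; linarith
  have hbr : |(1 - y) ^ k - k * y * (1 - y) ^ (k - 1)| ≤ 8 * s ^ (-a) := by
    have hsnn : 0 ≤ s ^ (-a) := Real.rpow_nonneg hs0.le _
    calc |(1 - y) ^ k - k * y * (1 - y) ^ (k - 1)|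
        ≤ |(1 - y) ^ k| + |k * y * (1 - y) ^ (k - 1)| := abs_sub _ _
      _ = (1 - y) ^ k + s * (1 - y) ^ (k - 1) := by
          rw [abs_of_nonneg (pow_nonneg h1y _), abs_of_nonneg (by positivity), hs]
      _ ≤ Real.exp (-s) + s * (Real.exp 1 * Real.exp (-s)) := by gcongr
      _ = Real.exp (-s) + Real.exp 1 * (s * Real.exp (-s)) := by ring
      _ ≤ 2 * s ^ (-a) + 3 * (2 * s ^ (-a)) := by gcongr
      _ = 8 * s ^ (-a) := by ring
  -- `s^{-a} = k^{-a} t^{2a}`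
  have hsk : s ^ (-a) = (k : ℝ) ^ (-a) * t ^ (2 * a) := by
    rw [hs, Real.mul_rpow hk0.le hy0.le, hy, Real.inv_rpow (by positivity), ← Real.rpow_neg
      (by positivity), ← Real.rpow_natCast, ← Real.rpow_mul ht0.le]
    norm_num
  -- assemble
  rw [norm_mul, Real.norm_eq_abs, Real.norm_eq_abs, abs_div, abs_neg, abs_two,
    abs_of_pos (by positivity : (0 : ℝ) < t ^ 3)]
  calc |(1 - y) ^ k - k * y * (1 - y) ^ (k - 1)| * (2 / t ^ 3)
      ≤ 8 * s ^ (-a) * (2 / t ^ 3) := by gcongr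
    _ = 16 * (k : ℝ) ^ (-a) * (t ^ (2 * a) * t ^ (-3 : ℝ)) := by
        rw [hsk, show (t ^ 3 : ℝ) = t ^ (3 : ℝ) by norm_cast, Real.rpow_neg ht0.le]
        ring
    _ = 16 * (k : ℝ) ^ (-a) * t ^ (2 * a - 3) := by
        rw [← Real.rpow_add ht0]; ring_nf

/-- The mean-value step: for `k ≥ 1`, `0 ≤ a ≤ 1`, `n ≥ 1`,
`|w_k(n+1) − w_k(n)| ≤ 16 k^{−a} n^{2a−3}`, `w_k(t) = t^{−2}(1−t^{−2})^k`.
[cite: BaezDuarte2005, §3 (summation by parts, estimate of the weight)] -/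
theorem abs_bdWeight_sub_le {k : ℕ} (hk : 1 ≤ k) {a : ℝ} (ha0 : 0 ≤ a) (ha1 : a ≤ 1) {n : ℕ}
    (hn : 1 ≤ n) :
    |(((n : ℝ) + 1) ^ 2)⁻¹ * (1 - (((n : ℝ) + 1) ^ 2)⁻¹) ^ k -
        ((n : ℝ) ^ 2)⁻¹ * (1 - ((n : ℝ) ^ 2)⁻¹) ^ k| ≤
      16 * (k : ℝ) ^ (-a) * (n : ℝ) ^ (2 * a - 3) := by
  have hn1 : (1 : ℝ) ≤ n := by exact_mod_cast hn
  have hn0 : (0 : ℝ) < n := by linarith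
  set g : ℝ → ℝ := fun t ↦ (t ^ 2)⁻¹ * (1 - (t ^ 2)⁻¹) ^ k with hg
  set g' : ℝ → ℝ := fun t ↦
    ((1 - (t ^ 2)⁻¹) ^ k - k * (t ^ 2)⁻¹ * (1 - (t ^ 2)⁻¹) ^ (k - 1)) * (-2 / t ^ 3) with hg'
  have hderiv : ∀ t ∈ Set.Icc (n : ℝ) (n + 1), HasDerivWithinAt g (g' t) (Set.Icc (n : ℝ) (n + 1)) t :=
    fun t ht ↦ (hasDerivAt_bdWeight k (by linarith [ht.1] : t ≠ 0)).hasDerivWithinAt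
  have hbound : ∀ t ∈ Set.Icc (n : ℝ) (n + 1), ‖g' t‖ ≤ 16 * (k : ℝ) ^ (-a) * (n : ℝ) ^ (2 * a - 3) := by
    intro t ht
    have ht1 : 1 ≤ t := hn1.trans ht.1
    have hpow : t ^ (2 * a - 3) ≤ (n : ℝ) ^ (2 * a - 3) :=
      Real.rpow_le_rpow_of_nonpos hn0 ht.1 (by linarith)
    have h1 : ‖g' t‖ ≤ 16 * (k : ℝ) ^ (-a) * t ^ (2 * a - 3) := norm_deriv_bdWeight_le hk ha0 ha1 ht1
    calc ‖g' t‖ ≤ 16 * (k : ℝ) ^ (-a) * t ^ (2 * a - 3) := h1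
      _ ≤ 16 * (k : ℝ) ^ (-a) * (n : ℝ) ^ (2 * a - 3) := by gcongr
  have hmvt := Convex.norm_image_sub_le_of_norm_hasDerivWithin_le hderiv hbound (convex_Icc _ _)
    (Set.left_mem_Icc.2 (by linarith)) (Set.right_mem_Icc.2 (by linarith))
  rw [Real.norm_eq_abs, Real.norm_eq_abs, show ((n : ℝ) + 1 - n) = 1 by ring, abs_one, mul_one] at hmvt
  simpa [hg] using hmvt

/-! ## §3 Báez-Duarte's Theorem 1.1, direction "⟹", and the discharge -/

/-- **RH ⟹ `c_k ≪ k^{−3/4+ε}`** (Báez-Duarte 2005, Thm. 1.1, necessity, §3), PROVED: summation by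
parts of `c_k = Σ μ(n) n^{−2}(1−n^{−2})^k` against `M(n)` with the tree's `RH ⟹ M(x) = O(x^{1/2+ε})`.
[cite: BaezDuarte2005, Thm. 1.1 and §3 (necessity)] -/
theorem baezDuarteCoeff_isBigO_of_riemannHypothesis (hRH : RiemannHypothesis) {ε : ℝ} (hε : 0 < ε) :
    (fun k : ℕ ↦ baezDuarteCoeff k) =O[atTop] fun k : ℕ ↦ (k : ℝ) ^ (-(3 / 4 : ℝ) + ε) := by
  -- reduce to `ε ≤ 1/2`
  wlog hε1 : ε ≤ 1 / 2 generalizing ε with H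
  · have h1 := H (ε := 1 / 2) (by norm_num) le_rfl
    refine h1.trans (IsBigO.of_bound 1 ?_)
    filter_upwards [eventually_ge_atTop 1] with k hk
    have hk1 : (1 : ℝ) ≤ k := by exact_mod_cast hk
    rw [one_mul, Real.norm_of_nonneg (by positivity), Real.norm_of_nonneg (by positivity)]
    exact Real.rpow_le_rpow_of_exponent_le hk1 (by linarith)
  set θ : ℝ := 1 / 2 + ε with hθ
  set a : ℝ := 3 / 4 - ε with ha
  have ha0 : 0 ≤ a := by rw [ha]; linarith
  have ha1 : a ≤ 1 := by rw [ha]; linarith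
  -- Mertens bound
  obtain ⟨C, hC0, hC⟩ := MertensDictionary.exists_bound_of_isBigO (θ := θ) (by rw [hθ]; linarith)
    (mertensFunction_isBigO_of_riemannHypothesis hRH hε)
  -- dominating series
  have hZs : Summable fun n : ℕ ↦ (n : ℝ) ^ (-1 - ε) := Real.summable_nat_rpow.2 (by linarith)
  set Z : ℝ := ∑' n : ℕ, (n : ℝ) ^ (-1 - ε) with hZ
  have hZ0 : 0 ≤ Z := tsum_nonneg fun n ↦ Real.rpow_nonneg (Nat.cast_nonneg n) _
  refine IsBigO.of_bound (16 * C * Z) ?_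
  filter_upwards [eventually_ge_atTop 1] with k hk
  have hk0 : (0 : ℝ) < k := by exact_mod_cast hk
  -- weight and coefficients
  set f : ℕ → ℝ := fun n ↦ ((n : ℝ) ^ 2)⁻¹ * (1 - ((n : ℝ) ^ 2)⁻¹) ^ k with hf
  set c : ℕ → ℝ := fun n ↦ ((ArithmeticFunction.moebius n : ℤ) : ℝ) with hc
  have hcS : ∀ i : ℕ, ∑ j ∈ range (i + 1), c j = (mertensFunction (i : ℝ) : ℝ) :=
    fun i ↦ sum_range_succ_moebius_eq_mertensFunction i
  have hf0 : ∀ n : ℕ, 1 ≤ n → 0 ≤ f n ∧ f n ≤ ((n : ℝ) ^ 2)⁻¹ := by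
    intro n hn
    have hn1 : (1 : ℝ) ≤ n := by exact_mod_cast hn
    have hy1 : ((n : ℝ) ^ 2)⁻¹ ≤ 1 := inv_le_one_of_one_le₀ (one_le_pow₀ hn1)
    have hy0 : 0 ≤ 1 - ((n : ℝ) ^ 2)⁻¹ := by linarith
    have hy0' : 0 ≤ ((n : ℝ) ^ 2)⁻¹ := by positivity
    refine ⟨by positivity, ?_⟩
    calc f n = ((n : ℝ) ^ 2)⁻¹ * (1 - ((n : ℝ) ^ 2)⁻¹) ^ k := rfl
      _ ≤ ((n : ℝ) ^ 2)⁻¹ * 1 := by gcongr; exact pow_le_one₀ hy0 (by linarith)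
      _ = ((n : ℝ) ^ 2)⁻¹ := mul_one _
  -- (a) `c_k = Σ f(n) c(n)`
  have hrep : HasSum (fun n ↦ f n * c n) (baezDuarteCoeff k) := hasSum_baezDuarteCoeff_moebius k
  -- (b) boundary terms
  have h0 : Tendsto (fun n : ℕ ↦ f n * ∑ j ∈ range (n + 1), c j) atTop (𝓝 0) := by
    have hlim : Tendsto (fun n : ℕ ↦ (1 : ℝ) / (n : ℝ)) atTop (𝓝 0) :=
      tendsto_const_div_atTop_nhds_zero_nat 1
    refine squeeze_zero_norm' ?_ hlim
    filter_upwards [eventually_ge_atTop 1] with n hn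
    have hn0 : (0 : ℝ) < n := by exact_mod_cast hn
    obtain ⟨hfn0, hfn⟩ := hf0 n hn
    rw [hcS, Real.norm_eq_abs, abs_mul, abs_of_nonneg hfn0]
    calc f n * |(mertensFunction (n : ℝ) : ℝ)| ≤ ((n : ℝ) ^ 2)⁻¹ * n := by
          gcongr
          exact MertensDictionary.abs_mertensFunction_natCast_le n
      _ = 1 / n := by field_simp
  -- (c) domination of the summed-by-parts series
  have hB : ∀ N : ℕ, ∑ i ∈ range N, |f (i + 1) - f i| * |∑ j ∈ range (i + 1), c j| ≤
      16 * C * Z * (k : ℝ) ^ (-a) := by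
    intro N
    have hterm : ∀ i ∈ range N, |f (i + 1) - f i| * |∑ j ∈ range (i + 1), c j| ≤
        16 * C * (k : ℝ) ^ (-a) * (i : ℝ) ^ (-1 - ε) := by
      intro i _
      rw [hcS]
      rcases Nat.eq_zero_or_pos i with rfl | hi
      · simp [MertensDictionary.mertensFunction_zero, Real.zero_rpow (by linarith : (-1 - ε : ℝ) ≠ 0)]
      have hi0 : (0 : ℝ) < i := by exact_mod_cast hi
      have h1 : |f (i + 1) - f i| ≤ 16 * (k : ℝ) ^ (-a) * (i : ℝ) ^ (2 * a - 3) := by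
        have := abs_bdWeight_sub_le hk ha0 ha1 (n := i) hi
        simpa [hf, Nat.cast_add, Nat.cast_one] using this
      have h2 := hC i hi
      calc |f (i + 1) - f i| * |(mertensFunction (i : ℝ) : ℝ)|
          ≤ (16 * (k : ℝ) ^ (-a) * (i : ℝ) ^ (2 * a - 3)) * (C * (i : ℝ) ^ θ) :=
            mul_le_mul h1 h2 (abs_nonneg _) (by positivity)
        _ = 16 * C * (k : ℝ) ^ (-a) * ((i : ℝ) ^ (2 * a - 3) * (i : ℝ) ^ θ) := by ring
        _ = 16 * C * (k : ℝ) ^ (-a) * (i : ℝ) ^ (-1 - ε) := by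
            rw [← Real.rpow_add hi0]; congr 1; rw [ha, hθ]; ring_nf
    calc ∑ i ∈ range N, |f (i + 1) - f i| * |∑ j ∈ range (i + 1), c j|
        ≤ ∑ i ∈ range N, 16 * C * (k : ℝ) ^ (-a) * (i : ℝ) ^ (-1 - ε) := Finset.sum_le_sum hterm
      _ = 16 * C * (k : ℝ) ^ (-a) * ∑ i ∈ range N, (i : ℝ) ^ (-1 - ε) := by rw [Finset.mul_sum]
      _ ≤ 16 * C * (k : ℝ) ^ (-a) * Z := by
          gcongr
          exact hZs.sum_le_tsum (range N) fun i _ ↦ Real.rpow_nonneg (Nat.cast_nonneg i) _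
      _ = 16 * C * Z * (k : ℝ) ^ (-a) := by ring
  -- (d) assemble
  have hmain := abs_tsum_mul_le_of_abel hrep.summable h0 hB
  rw [hrep.tsum_eq] at hmain
  have hka : (k : ℝ) ^ (-a) = (k : ℝ) ^ (-(3 / 4 : ℝ) + ε) := by rw [ha]; ring_nf
  rw [Real.norm_eq_abs, Real.norm_of_nonneg (by positivity : (0 : ℝ) ≤ (k : ℝ) ^ (-(3 / 4 : ℝ) + ε)),
    ← hka]
  exact hmain

/-- The same in the shape of the named fact: the left-hand side of `BaezDuarte2005_thm_1_1` implies
its right-hand side. [cite: BaezDuarte2005, Thm. 1.1 (necessity, §3)] -/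
theorem BaezDuarte2005_thm_1_1.mp_holds :
    RiemannHypothesis → ∀ ε : ℝ, 0 < ε →
      (fun k : ℕ ↦ baezDuarteCoeff k) =O[atTop] fun k : ℕ ↦ (k : ℝ) ^ (-(3 / 4 : ℝ) + ε) :=
  fun hRH _ hε ↦ baezDuarteCoeff_isBigO_of_riemannHypothesis hRH hε

/-- **DISCHARGE of the named fact `BaezDuarte2005_thm_1_1`** (Báez-Duarte, IJMMS 2005:21, Thm. 1.1:
"the Riemann hypothesis is true if and only if `c_k ≪ k^{−3/4+ε}` (∀ ε > 0)"; Broughan Vol. 2 Ch. 2,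
"Báez-Duarte series criterion"): `RiemannHypothesis ↔ ∀ ε > 0, c_k = O(k^{−3/4+ε})` is a THEOREM of
the tree — necessity by this file, sufficiency by `BaezDuarte2005_thm_1_1.mpr_holds`
(`BaezDuarteSequentialProofs`). An equivalence is proved; neither side is asserted.
[cite: BaezDuarte2005, Thm. 1.1; Broughan2017 Vol. 2 Ch. 2 (Index "Báez-Duarte series criterion")] -/
theorem BaezDuarte2005_thm_1_1_holds : BaezDuarte2005_thm_1_1 :=
  ⟨BaezDuarte2005_thm_1_1.mp_holds, BaezDuarte2005_thm_1_1.mpr_holds⟩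

end Literature.NumberTheory.LFunctions

end
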